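import Literature.MathematicalPhysics.QuantumFieldTheory.Balaban1983to89.B6SectAWholeTorusBridge

/-!
# `Balaban1983to89.B6SectAWholeTorusData` — T. Bałaban, *Propagators and renormalization transformations for lattice gauge
# theories. II*, Commun. Math. Phys. **96** (1984) 223–250 [Balaban1984PropagatorsII], Sect. A (2.6)/(2.20), (2.35) AT THE
# WHOLE-TORUS FAMILY `Ω₁ = … = Ω_k = T_η` (p. 224 «we admit the case when some domains Ω_j are equal to T_η»), companion of
# `B6SectAWholeTorusBridge`: the data space `L²(𝔅)` of the constraints (2.6)/(2.20) IS `L²` of the bonds of `T^{(k)}` (the space of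
# the data `B` of [Balaban1984PropagatorsI] (1.18)/(1.47)), and **(2.35) `H(B) = H_kB` of (4.4.2)/(1.63) for EVERY datum `B`**

statement-level skeleton of published theorems with citation tags; proofs where landed; nothing here is a claim about the
Yang–Mills mass gap

PDF held: `paper:balaban1984-cmp96-propagators-rt-ii` (journal page = PDF page + 222; pp. 223–226 [PDF 1–4], materialised text
`~/.lit/texts/paper-balaban1984-cmp96-propagators-rt-ii/p0001.txt … p0004.txt`, this seat); `paper:balaban1984-cmp95-propagators-rt-i`
(journal page = PDF page + 16); `paper:balaban1985-cmp97-bij-higgs-minimizers` (journal page = PDF page + 298).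

PRINT, verbatim.  [B6] p. 224: «Λ_j = Ω_j^{(j)} ∖ Ω_{j+1}^{(j)}, j = 1, …, k − 1, Λ_k = Ω_k^{(k)}, Λ₀ = Ω₁^c (2.3) … T = ⋃_{j=0}^k B^j(Λ_j)
(2.4) … A = B₀ on Λ₀, Q_jA = B_j on Λ_j, j = 1, …, k. (2.6)»; p. 226: «(QA)(b) = (Q_jA)(b) for b ∈ Λ_j, (Q₀A)(b) = A(b). (2.20)»;
p. 228: «A = HB = GQ*(QGQ*)⁻¹B. (2.35)».  [B5] p. 20: «(Q_kA)_b = Σ_{x∈B^k(b₋)} η^{d+1}A([x, x(b)]) (1.18)»; p. 28: «This defines the operator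
H_kB = A».  [BIJ85] p. 312: «the formula for the Landau gauge minimizer H_kB = Z_k(B)⁻¹∫𝒟A δ(Q_kA − B)𝒢(∂*A) A exp(−½‖∂A‖²), (4.4.2)».

CITATION HEADER (lean-in-tree rule) — WHAT IS REPRODUCED.  Phase-2 file of the `lit-balaban` typed skeleton (HOME
`run/shared/lean/pub/lit-balaban/`), seat **p16 gen 5** (owners r03 / r02 / r15, referee ref-4): KNITTING of rows **B6.Eq2.35** /
**B6.Eq2.19** ((2.20) data) with **B5.Eq1.63** / **B5.Eq1.11-1.18** / **C1.Eq4.4.1-4.4.3**, file 2/2 (file 1/2 =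
`B6SectAWholeTorusBridge`: the operators, (2.12), (2.35) on data `QA₀`, the minimal orbit).  At the whole-torus family
`B6SectADomainsV1.Domains.whole k` (p21) the index set `𝔅 = ⋃_j Λ_j` of p21's `BondIdx` has every index at level `k` (`Λ_j = ∅`, `j < k`):
NEW DEFINITIONS (with bodies) `idxB`/`eIdx : bonds of T^{(k)} ≃ 𝔅` and the isometric reindexing `rdE : L²(𝔅) ≃ₗᵢ L²(bonds of T^{(k)})`
(Mathlib's `LinearIsometryEquiv.piLpCongrLeft`); no `def … : Prop`, nothing is a named unproved fact.  Objects BY NAME: p21's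
`BondIdx`/`BondIdxSpace`/`QE`/`QsE`/`GE`/`EE`/`dcE`/`dsE`/`RE`, r03's `B6SectA.hOp`, `B6Eq218Lagrangian.IsCritical`, p11's `opsV1`/`Hk`,
gen 4's `B5Eq147TorusBridge.tVE`/`tVE_Hk`, `B5HkOpLandauMin.hkT`, `B5Eq117TorusCarriers.tB`.

WHAT IS PROVED (kernel, no `sorry`, standard axioms; `k ≤ m + K`, `c ≠ 0`, `s ≠ 0`, every `d ≥ 1`, every `a > 0`): `idxB_bijective`
(`𝔅 ≃` bonds of `T^{(k)}`); **`rdE_QE`**: the (2.20)-datum `QA`, reindexed, IS `Q_kA` of (1.18) (`QE_whole_eq_rdE_symm`);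
**`hOp_whole_rdE_symm`: `H(rdE⁻¹B) = Hk (opsV1 P k c s) B`** — (2.35) at the whole torus = (4.4.2) for EVERY `B`;
`tVE_hOp_whole_rdE_symm` (= the closed form (1.63) `hkT k (tB B)` on the tower); `isCritical_whole_rdE_symm_iff` (the unique critical
configuration of (2.5) under (2.6), (2.12) for the datum `rdE⁻¹B` is `H_kB`).

READINGS / HONEST SCOPE: as in file 1/2 (U = 1 real fields; `Λ₀ = ∅`; p11's operators weighted by `s`, p21's not — irrelevant for
every statement here).  GAPS.md: nothing.
-/

open scoped InnerProductSpace

namespace Literature.MathematicalPhysics.QuantumFieldTheory.Balaban1983to89.B6SectAWholeTorusData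

open LatticeFieldCalculus B6SectADomainsV1 B6SectAOperatorsV1 B6SectAVectorModelV1 B6SectACriticalPointV1 B6SectAWholeTorusBridge
open BalabanImbrieJaffe1984to88.BIJ85AxialPropagator411 (BondSpace)
open B6Eq218Lagrangian (IsCritical)
open BalabanImbrieJaffe1984to88.BIJ85LandauMinimizer442 (Hk)
open BalabanImbrieJaffe1984to88.BIJ85LandauMinimizer442V1 (opsV1 opsV1_Qk)

noncomputable section

variable {P : Params} {k : ℕ} (hk : k ≤ P.m + P.K) {c s : ℝ}

/-! ## The data space `L²(𝔅)` at the whole torus is `L²` of the bonds of `T^{(k)}`; (2.35) for EVERY datum `B` -/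

/-- the index of the `k`-bond `b ∈ Λ_k = T^{(k)}` in `𝔅 = ⋃_j Λ_j` of the whole-torus family. [cite: Balaban1984PropagatorsII, (2.3)–(2.4) p.224] -/
def idxB (b : PBond P k) : BondIdx (Domains.whole (P := P) k hk) := ⟨⟨Fin.last k, b⟩, (lamBond_whole_iff hk b).mpr rfl⟩

/-- unfolding. [cite: Balaban1984PropagatorsII, (2.3)–(2.4) p.224] -/
@[simp] theorem idxB_fst (b : PBond P k) : (idxB hk b).1 = ⟨Fin.last k, b⟩ := rfl

/-- `𝔅` of the whole-torus family IS (in bijection with) the set of bonds of `T^{(k)}`. [cite: Balaban1984PropagatorsII, (2.3)–(2.4) p.224] -/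
theorem idxB_bijective : Function.Bijective (idxB (P := P) hk) := by
  refine ⟨fun b b' h => ?_, fun i => ?_⟩
  · have h1 := congrArg (fun i : BondIdx (Domains.whole (P := P) k hk) => i.1) h
    simp only [idxB_fst, Sigma.mk.injEq, heq_eq_eq, true_and] at h1
    exact h1
  · obtain ⟨⟨j, b⟩, hb⟩ := i
    have hj : j = Fin.last k := Fin.ext ((lamBond_whole_iff hk b).mp hb)
    subst hj
    exact ⟨b, rfl⟩

/-- `𝔅 ≃ bonds of T^{(k)}` as an equivalence. [cite: Balaban1984PropagatorsII, (2.3)–(2.4) p.224] -/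
def eIdx : PBond P k ≃ BondIdx (Domains.whole (P := P) k hk) := Equiv.ofBijective (idxB hk) (idxB_bijective hk)

/-- unfolding. [cite: Balaban1984PropagatorsII, (2.3)–(2.4) p.224] -/
@[simp] theorem eIdx_apply (b : PBond P k) : eIdx hk b = idxB hk b := rfl

/-- **`L²(𝔅) ≅ L²(bonds of T^{(k)})`**: the isometric reindexing of the data space of (2.6)/(2.20) at the whole torus onto the space of
the data `B` of [B5] (1.18)/(1.47). [cite: Balaban1984PropagatorsII, (2.20) p.226] -/
def rdE : BondIdxSpace (Domains.whole (P := P) k hk) ≃ₗᵢ[ℝ] EuclideanSpace ℝ (PBond P k) :=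
  LinearIsometryEquiv.piLpCongrLeft 2 ℝ ℝ (eIdx hk).symm

/-- componentwise. [cite: Balaban1984PropagatorsII, (2.20) p.226] -/
@[simp] theorem rdE_apply (B' : BondIdxSpace (Domains.whole (P := P) k hk)) (b : PBond P k) : rdE hk B' b = B' (idxB hk b) := by
  simp [rdE, LinearIsometryEquiv.piLpCongrLeft_apply]

/-- **the multi-scale datum `QA` of (2.20) at the whole torus, reindexed, IS `Q_kA` of (1.18).** [cite: Balaban1984PropagatorsI, (1.18) p.20] -/
theorem rdE_QE (x : BondSpace P) :
    rdE hk (QE (Domains.whole (P := P) k hk) x) = WithLp.toLp 2 (bondAvgIter k (WithLp.ofLp x)) := by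
  ext b
  rw [rdE_apply, QE_whole_apply]
  rfl

/-- … equivalently `QA = rdE⁻¹(Q_kA)`. [cite: Balaban1984PropagatorsI, (1.18) p.20] -/
theorem QE_whole_eq_rdE_symm (x : BondSpace P) :
    QE (Domains.whole (P := P) k hk) x = (rdE hk).symm (WithLp.toLp 2 (bondAvgIter k (WithLp.ofLp x))) := by
  rw [← rdE_QE hk x, LinearIsometryEquiv.symm_apply_apply]

/-- **(2.35) = (4.4.2)/(1.63) for EVERY datum `B` on `T^{(k)}`**: `H(rdE⁻¹B) = H_kB`. [cite: BalabanImbrieJaffe1985, (4.4.2) p.312] -/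
theorem hOp_whole_rdE_symm (hc : c ≠ 0) (hs : s ≠ 0) {w : BondIdx (Domains.whole (P := P) k hk) → ℝ} (hw : ∀ i, 0 < w i)
    (B : VecField P k ℝ) :
    B6SectA.hOp (GE (Domains.whole (P := P) k hk) hc hw) (QsE (Domains.whole (P := P) k hk))
        (EE (Domains.whole (P := P) k hk) hc hw) ((rdE hk).symm (WithLp.toLp 2 B)) =
      Hk (opsV1 P k c s) B := by
  obtain ⟨x₀, hx₀⟩ := BalabanImbrieJaffe1984to88.BIJ85LandauMinimizer442V1.fibre_nonempty_V1 hk c s B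
  rw [opsV1_Qk] at hx₀
  rw [← hx₀, ← QE_whole_eq_rdE_symm hk x₀, hOp_whole_eq_Hk hk hc hs hw x₀, opsV1_Qk]

/-- … and on the tower: `tVE (H(rdE⁻¹B)) = hkT k (tB B)` = the closed form (1.63). [cite: Balaban1984PropagatorsI, (1.63) p.28] -/
theorem tVE_hOp_whole_rdE_symm (hc : c ≠ 0) (hs : s ≠ 0) {w : BondIdx (Domains.whole (P := P) k hk) → ℝ} (hw : ∀ i, 0 < w i)
    (B : VecField P k ℝ) :
    B5Eq147TorusBridge.tVE P hk (B6SectA.hOp (GE (Domains.whole (P := P) k hk) hc hw) (QsE (Domains.whole (P := P) k hk))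
        (EE (Domains.whole (P := P) k hk) hc hw) ((rdE hk).symm (WithLp.toLp 2 B))) =
      B5HkOpLandauMin.hkT P.L (B5Eq117TorusCarriers.Mk P k) k (B5Eq117TorusCarriers.tB B) := by
  rw [hOp_whole_rdE_symm hk hc hs hw B, B5Eq147TorusBridge.tVE_Hk hk hc hs]

/-- the unique critical configuration of (2.5) under (2.6), (2.12) at the whole torus, for the datum `rdE⁻¹B`, is `H_kB`. [cite: Balaban1984PropagatorsII, (2.35) p.228] -/
theorem isCritical_whole_rdE_symm_iff (hc : c ≠ 0) (hs : s ≠ 0) (B : VecField P k ℝ) (x : BondSpace P) :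
    IsCritical (dcE c) (QE (Domains.whole (P := P) k hk)) (dsE c) (RE (Domains.whole (P := P) k hk) c)
        ((rdE hk).symm (WithLp.toLp 2 B)) x ↔ x = Hk (opsV1 P k c s) B := by
  have hw : ∀ i : BondIdx (Domains.whole (P := P) k hk), 0 < (fun _ => (1 : ℝ)) i := fun _ => one_pos
  rw [isCritical_iff_eq_hOp _ hc hw, hOp_whole_rdE_symm hk hc hs hw]

end

end Literature.MathematicalPhysics.QuantumFieldTheory.Balaban1983to89.B6SectAWholeTorusData
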